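import Literature.NumberTheory.EllipticCurves.TakahashiDegreeFormulaCoprimeProofs
import Summits.ABC.ABC.Theses.DefiniteXi
import HarnessLib

/-!
# STUB-IDEAS companion — `stub_xiDegreeComparison` · ideator k1 · generation 34 (FAMILY 1: recognise & import)

Crux `stmt-ABC-15024` (`Summit.ABC.ABC.Theses.DefiniteXi.SteinbergCore`), line `p6_tamagawa_split`,
registered stub `stub_xiDegreeComparison` (child 1: `ξ ≠ 0 → ∃ D deg-minimal ∧ cps ξ ≤ C_ε N^ε·cps(deg D)·T³`).

RECOGNISE (gen 34).  At PRIME type `Nm = q` the stub's conclusion is a ONE-SIDED divisibility and its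
`∃ D`-minimal binder is satisfied by ANY datum, so the import it needs is not Takahashi 2001 Thm 2.3
(optimal quotient, two-sided `deg P⋆ · i = ξ · j`, hence the pivots + Mazur–Kenku/`163` + Pasten L.6.8 of
p137891, or the optimal-`P` dictionary H-D0 + `MazurKenkuBound` + `IsogenyValuationTransport` of k1 g31)
but only GROTHENDIECK'S ADJUNCTION for the parametrisation `π_D : J₀(Mq) → E_(a,b)` induced by the
minimal datum `D` itself: `⟨π^*1, π^*1⟩_J = c_q(E) · deg D` in the character group `X_q(J₀(Mq)) ≅ ℤ[Cls O]⁰`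
(Ribet 1990 (3.1)–(3.3); Diamond 1997 §3; SGA7 IX), and `π^*1 = n φ` on the `a(E)`-eigen-line (`ξ ≠ 0`).
Hence `n² ξ = c_q(E) · deg D`, i.e. `cps ξ ≤ cps(deg D) · c_q(E) ≤ cps(deg D) · T` with `C = 1` —
modulo the WEAK any-datum dictionary `WeakCharGroupDictionary` (3 of the 5 conjuncts of g31's H-D0, no
minimality premise, no surjectivity, no saturation) and `FreyModularity` only.
W2/W2′ (the mechanism) are kernel-checked here; W3a/W3 are one prover cycle (recipe in the docstrings).
[cite: Ribet1990, §3 (3.1)–(3.3)] [cite: Takahashi2001, Prop. 1.1 (p. 80)] [cite: ConradStein2001, §2.1]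
-/

set_option linter.dupNamespace false

noncomputable section

namespace Summit.ABC.ABC.Cruxes.SteinbergCore.StubIdeasK1G34

open scoped BigOperators
open Literature.NumberTheory.EllipticCurves Literature.NumberTheory.EllipticCurves.ModularForms
open Literature.NumberTheory.Automorphic

/-- **W1** (named-fact candidate, `Literature/NumberTheory/Automorphic`): the WEAK character-group
dictionary at `r ∥ N`, for an ARBITRARY datum `P` of `W` (conductor `M r`) and every Brandt setup `S`
of type `(M, r)`: the character group `X = X_r(J₀(Mr))` sits in the weighted Brandt lattice `ℤ[Cls O]`
with Grothendieck's pairing `Σ_i w_i x_i y_i`; `pb = π_P^*` on `X_r(E) = ℤ` (generator `1`, `⟨1,1⟩_E =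
ord_r Δ_min(W)`), `pf = (π_P^∨)^*`; (1) adjunction `⟨π^* a, y⟩_J = c_r(W) · a · π_* y`, (2) `π_* π^* = deg P`,
(5) `π^* 1` is a `T_p`-eigenvector with eigenvalues `a_p(W)`, `p ∤ Mr`.  Conjuncts (1)(2)(5) of k1 g31's
`characterGroupDictionary_of_coprime` WITHOUT its optimality premise on `P`, its surjectivity of `π_*`
and its saturation of `X` (none is needed for a one-sided bound).  `W` is multiplicative at `r`, so not CM,
so every analytic datum's map `X₀(Mr) → W` is `ℚ`-rational and factors through the optimal quotient
(`π_P T_p = a_p π_P`).  NO multiplicity one, NO Jacquet–Langlands, NO optimality.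
[cite: Ribet1990, §3 (3.1)–(3.3)] [cite: Takahashi2001, Prop. 1.1 (p. 80)] [cite: ConradStein2001, §2.1] -/
def WeakCharGroupDictionary : Prop :=
  ∀ (W : WeierstrassCurve ℚ) [W.IsElliptic] (M r : ℕ) [NeZero (M * r)],
    r.Prime → M.Coprime r → W.conductorNorm ℤ = M * r →
    ∀ (P : ModularParametrizationData W (M * r))
      (S : Brandt.XiSetup M r) [Fintype (Brandt.ClassSet S.O)],
      ∃ (X : Submodule ℤ (Brandt.ClassSet S.O → ℤ)) (pb : ℤ →ₗ[ℤ] X) (pf : X →ₗ[ℤ] ℤ),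
        (∀ (a : ℤ) (y : X),
            ∑ i, (Brandt.weight S.O i : ℤ) * (pb a : Brandt.ClassSet S.O → ℤ) i *
                (y : Brandt.ClassSet S.O → ℤ) i =
              ((W.minimalDiscriminantNorm ℤ).factorization r : ℤ) * a * pf y) ∧
        (∀ a : ℤ, pf (pb a) = (P.deg : ℤ) * a) ∧
        (pb 1 : Brandt.ClassSet S.O → ℤ) ∈
          Brandt.eigenLattice (M * r) (Brandt.matrix S.O) (fun n => W.LFunction n)

/-- **W2** (XS, PROVED — the mechanism, Brandt-free linear algebra): if `X ⊆ ℤ^ι` carries maps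
`pb : ℤ → X`, `pf : X → ℤ` with the adjunction `Σ w_i (pb a)_i y_i = c · a · pf y` and `pf (pb a) = d · a`,
`d ≠ 0`, and `pb 1` lies in a lattice `L` whose `ξ = Σ w_i φ_i²` (`L = ℤφ`) is non-zero, then
`ξ · n² = c · d` for some `n ≠ 0` (`pb 1 = n φ`).  [folklore] -/
theorem exists_xi_mul_eq_of_pairing {ι : Type*} [Fintype ι] (w : ι → ℕ)
    {L X : Submodule ℤ (ι → ℤ)} (pb : ℤ →ₗ[ℤ] X) (pf : X →ₗ[ℤ] ℤ) {c d : ℕ}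
    (hpair : ∀ (a : ℤ) (y : X),
      ∑ i, (w i : ℤ) * (pb a : ι → ℤ) i * (y : ι → ℤ) i = (c : ℤ) * a * pf y)
    (hdeg : ∀ a : ℤ, pf (pb a) = (d : ℤ) * a)
    (hmem : ((pb 1 : X) : ι → ℤ) ∈ L) (hξ : Brandt.xi w L ≠ 0) (hd : d ≠ 0) :
    ∃ m : ℕ, m ≠ 0 ∧ Brandt.xi w L * m = c * d := by
  classical
  by_cases hline : ∃ φ : ι → ℤ, φ ≠ 0 ∧ L = ℤ ∙ φ
  swap
  · exact absurd (Brandt.xi_of_not_isLine w hline) hξ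
  obtain ⟨φ, hφ, hL⟩ := hline
  have hmem' : ((pb 1 : X) : ι → ℤ) ∈ (ℤ ∙ φ : Submodule ℤ (ι → ℤ)) := hL ▸ hmem
  obtain ⟨n, hn⟩ := Submodule.mem_span_singleton.mp hmem'
  -- the adjunction identity at `a = 1`, `y = pb 1`
  have key : ∑ i, (w i : ℤ) * (pb 1 : ι → ℤ) i * (pb 1 : ι → ℤ) i = (c : ℤ) * (d : ℤ) := by
    rw [hpair 1 (pb 1), hdeg 1]; ring
  have hlhs : ∑ i, (w i : ℤ) * (pb 1 : ι → ℤ) i * (pb 1 : ι → ℤ) i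
      = n ^ 2 * ∑ i, (w i : ℤ) * (φ i) ^ 2 := by
    rw [← hn, Finset.mul_sum]
    exact Finset.sum_congr rfl fun i _ => by simp only [Pi.smul_apply, smul_eq_mul]; ring
  have hsum : ((∑ i, w i * (φ i).natAbs ^ 2 : ℕ) : ℤ) = ∑ i, (w i : ℤ) * (φ i) ^ 2 := by
    push_cast
    exact Finset.sum_congr rfl fun i _ => by simp [sq_abs]
  -- `n ≠ 0`: otherwise `pb 1 = 0` and `d = pf (pb 1) = 0`
  have hn0 : n ≠ 0 := by
    rintro rfl
    have h0 : (pb 1 : X) = 0 := Subtype.ext (by rw [← hn, zero_smul]; rfl)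
    have h1 := hdeg 1
    rw [h0, map_zero, mul_one] at h1
    exact hd (by exact_mod_cast h1.symm)
  refine ⟨n.natAbs ^ 2, pow_ne_zero 2 (Int.natAbs_ne_zero.mpr hn0), ?_⟩
  rw [Brandt.xi_eq_sum w hφ hL]
  have hn2 : ((n.natAbs ^ 2 : ℕ) : ℤ) = n ^ 2 := by
    push_cast
    simp [sq_abs]
  have : ((∑ i, w i * (φ i).natAbs ^ 2 : ℕ) : ℤ) * ((n.natAbs ^ 2 : ℕ) : ℤ) = ((c * d : ℕ) : ℤ) := by
    rw [hsum, hn2]; push_cast; rw [← key, hlhs]; ring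
  exact_mod_cast this

/-- **W2′** (XS, PROVED modulo W1): for ANY datum `P` of a curve `W` of conductor `M r` (`r ∥ N`) and
any setup `S` with `ξ_S(a(W)) ≠ 0`: `ξ_S · m = c_r(W) · deg P` for some `m ≠ 0`; in particular
`ξ_S ∣`-free consequence `cps ξ_S ≤ cps (deg P) · c_r(W)`.  [cite: Takahashi2001, Prop. 1.1 (p. 80)] -/
theorem exists_xi_mul_eq_tamagawa_mul_deg (hW : WeakCharGroupDictionary)
    (W : WeierstrassCurve ℚ) [W.IsElliptic] (M r : ℕ) [NeZero (M * r)]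
    (hr : r.Prime) (hcop : M.Coprime r) (hN : W.conductorNorm ℤ = M * r)
    (P : ModularParametrizationData W (M * r)) (S : Brandt.XiSetup M r)
    [Fintype (Brandt.ClassSet S.O)]
    (hξ : S.xi (fun n => W.LFunction n) ≠ 0) :
    ∃ m : ℕ, m ≠ 0 ∧ S.xi (fun n => W.LFunction n) * m
      = (W.minimalDiscriminantNorm ℤ).factorization r * P.deg := by
  obtain ⟨X, pb, pf, hpair, hdeg, hmem⟩ := hW W M r hr hcop hN P S
  have hx : S.xi (fun n => W.LFunction n)
      = Brandt.xi (Brandt.weight S.O)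
          (Brandt.eigenLattice (M * r) (Brandt.matrix S.O) fun n => W.LFunction n) := by
    show Brandt.xiOfOrder S.O (M * r) _ = _
    rw [Brandt.xiOfOrder_eq]
  rw [hx] at hξ ⊢
  exact exists_xi_mul_eq_of_pairing (Brandt.weight S.O) pb pf hpair hdeg hmem hξ P.deg_pos.ne'

/-- The PRIME-TYPE form of the stub (conclusion of `xiDegreeComparison_prime_of_facts`, p137891,
VERBATIM; = k1 g31 `PrimeTypeComparison`). [cite: Takahashi2001, Thm. 2.3] -/
def PrimeTypeComparison : Prop :=
    ∀ ε : ℝ, 0 < ε → ∃ C : ℝ, ∀ a b : ℤ, IsCoprime a b → a * b * (a + b) ≠ 0 → ∀ (N : ℕ) [NeZero N],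
      (Literature.NumberTheory.EllipticCurves.freyCurve a b).conductorNorm ℤ = N →
      ∀ q : ℕ, q.Prime → q ≠ 2 → q ∣ N →
      Literature.NumberTheory.Automorphic.brandtXi (N / q) q
          (fun n => (Literature.NumberTheory.EllipticCurves.freyCurve a b).LFunction n) ≠ 0 →
      ∃ D : Literature.NumberTheory.EllipticCurves.ModularForms.ModularParametrizationData
        (Literature.NumberTheory.EllipticCurves.freyCurve a b) N,
        (∀ D' : Literature.NumberTheory.EllipticCurves.ModularForms.ModularParametrizationData
          (Literature.NumberTheory.EllipticCurves.freyCurve a b) N, D.deg ≤ D'.deg) ∧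
        ((Literature.NumberTheory.Automorphic.brandtXi (N / q) q
              (fun n => (Literature.NumberTheory.EllipticCurves.freyCurve a b).LFunction n) /
            (ordProj[2] (Literature.NumberTheory.Automorphic.brandtXi (N / q) q
                (fun n => (Literature.NumberTheory.EllipticCurves.freyCurve a b).LFunction n)) *
              ordProj[3] (Literature.NumberTheory.Automorphic.brandtXi (N / q) q
                (fun n => (Literature.NumberTheory.EllipticCurves.freyCurve a b).LFunction n))) : ℕ) : ℝ) ≤
          C * (N : ℝ) ^ ε * ((D.deg / (ordProj[2] D.deg * ordProj[3] D.deg) : ℕ) : ℝ) *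
            ((∏ p ∈ N.primeFactors, ((Literature.NumberTheory.EllipticCurves.freyCurve a b).minimalDiscriminantNorm
              ℤ).factorization p : ℕ) : ℝ) ^ 3

/-- **W3a** (S, ONE prover cycle; NOT proved here): the `ℕ`-chain at prime type for ANY datum `D`:
`cps ξ(M;q) ≤ cps (deg D) · c_q(E)`.  Recipe: a setup `S` exists because `ξ ≠ 0`
(`brandtXi_of_isEmpty`), `brandtXi M q = S.xi` (`Brandt.XiSetup.brandtXi_eq_xi`), `gcd(M,q) = 1`
(`DefiniteRTControlPrime.stub_freyLocal`, landed), W2′ gives `ξ · m = c_q · deg D` with `m ≠ 0`, then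
`cps ξ ≤ cps (ξ m) = cps (deg D · c_q) = cps (deg D) · cps c_q ≤ cps (deg D) · c_q`
(`SteinbergCore.Negative.primeToSix_le_primeToSix_mul / primeToSix_mul / primeToSix_le`, or restate
these 5-line lemmas if that module is farm-stale). [cite: Takahashi2001, Prop. 1.1 (p. 80)] -/
theorem primeToSix_xi_le_of_weakDictionary (hW : WeakCharGroupDictionary) :
    ∀ a b : ℤ, IsCoprime a b → a * b * (a + b) ≠ 0 → ∀ (N : ℕ) [NeZero N],
      (freyCurve a b).conductorNorm ℤ = N → ∀ q : ℕ, q.Prime → q ≠ 2 → q ∣ N →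
      brandtXi (N / q) q (fun n => (freyCurve a b).LFunction n) ≠ 0 →
      ∀ D : ModularParametrizationData (freyCurve a b) N,
        brandtXi (N / q) q (fun n => (freyCurve a b).LFunction n) /
            (ordProj[2] (brandtXi (N / q) q (fun n => (freyCurve a b).LFunction n)) *
              ordProj[3] (brandtXi (N / q) q (fun n => (freyCurve a b).LFunction n)))
          ≤ D.deg / (ordProj[2] D.deg * ordProj[3] D.deg) *
            ((freyCurve a b).minimalDiscriminantNorm ℤ).factorization q := by
  sorry

/-- **W3** (S, same prover cycle; NOT proved here): the prime-type child with `C = 1` from the WEAK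
dictionary and `FreyModularity` ALONE — versus p137891 (`takahashi2001_thm_2_3_of_coprime` +
`PastenShimura2024_minimalDegree_le_163_mul` + `PastenShimura2024_lemma_6_8` + `FreyModularity`,
`C = 4·163²`) and k1 g31 H-D3′ (dictionary H-D0 + `MazurKenkuBound` + `IsogenyValuationTransport` +
`FreyModularity`).  Recipe: minimal datum `D` (`exists_minimal_datum`, well-ordering, from
`FreyModularity`), W3a at `D`, `c_q ≤ T` (`Finset.dvd_prod_of_mem` + `1 ≤` each factor,
`ManyPrimeValuationProduct.one_le_factorization_of_mem_primeFactors_conductorNorm`), `T ≤ T³`, `1 ≤ N^ε`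
(`XiDegreeComparisonPrime.cast_le_of_chain` pattern with constant `1`). [cite: Takahashi2001, Prop. 1.1 (p. 80)] -/
theorem primeTypeComparison_of_weakDictionary (hW : WeakCharGroupDictionary)
    (hMod : Summit.ABC.ABC.Theses.DefiniteXi.FreyModularity) : PrimeTypeComparison := by
  sorry

end Summit.ABC.ABC.Cruxes.SteinbergCore.StubIdeasK1G34

end
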